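import Summits.QuantumFields.QCD.Theorems.SpectralDefectExtinctionTipPricingStubCountMeasurable
import Literature.MathematicalPhysics.QuantumFieldTheory.QCDPhaseQuenchedReweighting

/-!
# Candidate proof of stub S1 `stub_negCountMeasurable` (line `free-volume-heavy-witness`,
crux `WindowExtinction`, stmt-QuantumFields-8964) — drefute seat, attached as EVIDENCE for the lead
(refuters do not land positive stubs).

`U ↦ n₋(Γ₅ D_W(U, m₀, 1))` (negative roots of the characteristic polynomial, with multiplicity) is
measurable on `SU(3)^{edges}`: an instance of the LANDED general theorem
`Summit.QuantumFields.QCD.Cruxes.TipPricing.HermitianFlowCoarea.countMeas_measurable_countP`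
(Theorems/SpectralDefectExtinctionTipPricingStubCountMeasurable.lean: continuous matrix-valued map +
predicate whose truth set is an increasing countable union of closed sets), with
`{re < 0} = ⋃ⱼ {re ≤ −1/(j+1)}` and continuity of `U ↦ Γ₅ D_W(U, m₀, 1)` (`continuous_wilsonDirac`).
-/

noncomputable section

namespace Summit.QuantumFields.QCD.Cruxes.WindowExtinction.FreeVolumeHeavyWitness.Drefute

open Literature.MathematicalPhysics.QuantumLattice Literature.MathematicalPhysics.QuantumFieldTheory
  Literature.Probability.LatticeModels
open Summit.QuantumFields.QCD.Cruxes.TipPricing.HermitianFlowCoarea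

/-- **S1 (`NegCountMeasurable`) holds**: measurability of the negative-eigenvalue count of the
Hermitian Wilson–Dirac operator as a function of the gauge field, for every torus and bare mass. -/
theorem negCountMeasurable_proof :
    ∀ (n : ℕ) [NeZero n] (m₀ : ℝ), Measurable fun U : GaugeConfig 4 n SU3 =>
      (spinorLift gammaFive * wilsonDirac (fundamentalRep (Fin 3)) U m₀ 1).charpoly.roots.countP
        fun z : ℂ => z.re < 0 := by
  intro n _ m₀
  have hA : Continuous fun U : GaugeConfig 4 n SU3 =>
      spinorLift gammaFive * wilsonDirac (fundamentalRep (Fin 3)) U m₀ 1 :=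
    continuous_const.matrix_mul (continuous_wilsonDirac _ (continuous_fundamentalRep (Fin 3)) m₀ 1)
  refine countMeas_measurable_countP hA (fun z : ℂ => z.re < 0)
    (fun j => {z : ℂ | z.re ≤ -(1 / ((j : ℝ) + 1))}) (fun j => ?_) (fun j k hjk => ?_) (fun z => ?_)
  · exact isClosed_le Complex.continuous_re continuous_const
  · intro z hz
    simp only [Set.mem_setOf_eq] at hz ⊢
    have : (1 : ℝ) / ((k : ℝ) + 1) ≤ 1 / ((j : ℝ) + 1) :=
      one_div_le_one_div_of_le (by positivity) (by exact_mod_cast Nat.succ_le_succ hjk)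
    linarith
  · constructor
    · intro h
      obtain ⟨j, hj⟩ := exists_nat_one_div_lt (neg_pos.mpr h)
      exact ⟨j, by simp only [Set.mem_setOf_eq]; linarith⟩
    · rintro ⟨j, hj⟩
      simp only [Set.mem_setOf_eq] at hj
      have : (0 : ℝ) < 1 / ((j : ℝ) + 1) := by positivity
      linarith

end Summit.QuantumFields.QCD.Cruxes.WindowExtinction.FreeVolumeHeavyWitness.Drefute

end
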